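import Summits.KontsevichZagierPeriods.KontsevichZagierPeriods.Theorems.TerasomaMultiplicationMultiplicationAccessibleCornerThetaDerivBoundGenAux2
import Summits.KontsevichZagierPeriods.KontsevichZagierPeriods.Theorems.TerasomaMultiplicationMultiplicationAccessibleCornerClosedGen

/-!
# `MultiplicationAccessible` (stmt-KontsevichZagierPeriods-12305), line `shifted-family-prime-sieve`:
the `θ_i`-derivative bound of the corner Stokes, all `p = n + 2` (`cornerThetaDerivBoundGen`)

On the open chart domain `W` the lateral Stokes component is
`Vθ i = v^(px−1)(1 − vZ)^(ps−1) H^(ps) K · θ_i · B / y`, `B = Σ_j Θ_j (M_{i+1} − M_j)`, with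
`H = y/(1 − Z)` there. Along a `θ_i`-slice its derivative exists (product/chain rule; all bases
positive) and is BOUNDED (`x ≥ 2`, `s ≥ 3`): `|B| ≤ x y` absorbs `1/y`, and the singular slice
derivative `Z' ∼ y²Z/(p t₀ t_{i+1})` is compensated by `|B| ≤ 2 t₀ t_{i+1}` and `1 − Z ≥ y/p`.
References: Kontsevich–Zagier 2001 §1.2 rule (3).
-/

noncomputable section

open MeasureTheory Set Real
open scoped BigOperators Topology
open Literature.NumberTheory.Transcendental
open Literature.NumberTheory.Transcendental.KZ

namespace Summit.KontsevichZagierPeriods.TerasomaMultiplication.MultiplicationAccessible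

namespace CornerThetaDeriv

variable {n : ℕ}

/-- **The five-term estimate** behind the derivative bound: pure real arithmetic on the ranges of the
factors (`C, Qa, Qb, K, a ∈ [0,1]`, `Ha ≤ G`, `Hb ≤ G/p`) and the two compensations
`|Z'|·|B| ≤ 2y`, `|Z'|·|B|/(1−Z)² ≤ 2p`. [folklore] -/
theorem five_terms_le {C v p s x Qa Qb Ha Hb G Ku av Z' Bv y K' B' Zu : ℝ}
    (hC0 : 0 ≤ C) (hC1 : C ≤ 1) (hv0 : 0 ≤ v) (hv1 : v ≤ 1) (hp0 : 0 < p) (hp2 : 2 ≤ p) (hs : 3 ≤ s) (hx : 2 ≤ x)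
    (hQa0 : 0 ≤ Qa) (hQa1 : Qa ≤ 1) (hQb0 : 0 ≤ Qb) (hQb1 : Qb ≤ 1) (hG0 : 0 ≤ G)
    (hHa0 : 0 ≤ Ha) (hHaG : Ha ≤ G) (hHb0 : 0 ≤ Hb) (hHbG : Hb ≤ G / p) (hK0 : 0 ≤ Ku) (hK1 : Ku ≤ 1)
    (ha0 : 0 ≤ av) (ha1 : av ≤ 1) (hy0 : 0 < y) (h1Z : 0 < 1 - Zu)
    (hZB1 : |Z'| * |Bv| ≤ 2 * y) (hZB2 : |Z'| * |Bv| / (1 - Zu) ^ 2 ≤ 2 * p) (hB1 : |Bv| ≤ x * y)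
    (hKb : |K'| ≤ p * s) (hBb : |B'| ≤ p * (x * y + 2 * (p * (x * y)))) :
    |-(C * v * (p * s - 1) * Qa * Ha * Ku * av) * (Z' * Bv) / y +
      (C * Qb * (p * s) * Hb * Ku * av) * ((Z' * Bv) / (1 - Zu) ^ 2) * (y / y) +
      (C * Qb * Ha) * K' * av * Bv / y +
      (C * Qb * Ha * Ku) * Bv / y +
      (C * Qb * Ha * Ku) * av * B' / y| ≤ G * (4 * (p * s) + p * s * x + x + p * x + 2 * p ^ 2 * x) := by
  have hs0 : (0:ℝ) < s := by linarith
  have hx0 : (0:ℝ) < x := by linarith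
  have hps : (6:ℝ) ≤ p * s := by nlinarith
  have hGp : G / p * p = G := div_mul_cancel₀ G hp0.ne'
  have hyy : y / y = 1 := div_self hy0.ne'
  have hN1 : C * v * (p * s - 1) * Qa * Ha * Ku * av ≤ 1 * 1 * (p * s) * 1 * G * 1 * 1 := by
    have h1 : p * s - 1 ≤ p * s := by linarith
    have h2 : (0:ℝ) ≤ p * s - 1 := by linarith
    exact mul_le_mul (mul_le_mul (mul_le_mul (mul_le_mul (mul_le_mul (mul_le_mul hC1 hv1 hv0 zero_le_one)
      h1 h2 (by positivity)) hQa1 hQa0 (by positivity)) hHaG hHa0 (by positivity)) hK1 hK0 (by positivity))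
      ha1 ha0 (by positivity)
  have hN1' : 0 ≤ C * v * (p * s - 1) * Qa * Ha * Ku * av := by
    have : (0:ℝ) ≤ p * s - 1 := by linarith
    positivity
  have ht1 : |-(C * v * (p * s - 1) * Qa * Ha * Ku * av) * (Z' * Bv) / y| ≤ 2 * (p * s) * G := by
    rw [abs_div, abs_mul, abs_neg, abs_of_nonneg hN1', abs_of_pos hy0, abs_mul, div_le_iff₀ hy0]
    calc C * v * (p * s - 1) * Qa * Ha * Ku * av * (|Z'| * |Bv|) ≤ (1 * 1 * (p * s) * 1 * G * 1 * 1) * (2 * y) :=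
          mul_le_mul hN1 hZB1 (mul_nonneg (abs_nonneg _) (abs_nonneg _)) (by positivity)
      _ = 2 * (p * s) * G * y := by ring
  have hN2 : C * Qb * (p * s) * Hb * Ku * av ≤ 1 * 1 * (p * s) * (G / p) * 1 * 1 :=
    mul_le_mul (mul_le_mul (mul_le_mul (mul_le_mul (mul_le_mul hC1 hQb1 hQb0 zero_le_one) le_rfl
      (by positivity) (by positivity)) hHbG hHb0 (by positivity)) hK1 hK0 (by positivity)) ha1 ha0 (by positivity)
  have hN2' : 0 ≤ C * Qb * (p * s) * Hb * Ku * av := by positivity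
  have ht2 : |(C * Qb * (p * s) * Hb * Ku * av) * ((Z' * Bv) / (1 - Zu) ^ 2) * (y / y)| ≤ 2 * (p * s) * G := by
    rw [hyy, mul_one, abs_mul, abs_of_nonneg hN2', abs_div, abs_mul, abs_of_pos (pow_pos h1Z 2)]
    calc C * Qb * (p * s) * Hb * Ku * av * (|Z'| * |Bv| / (1 - Zu) ^ 2)
        ≤ (1 * 1 * (p * s) * (G / p) * 1 * 1) * (2 * p) :=
          mul_le_mul hN2 hZB2 (by positivity) (by positivity)
      _ = 2 * (p * s) * (G / p * p) := by ring
      _ = 2 * (p * s) * G := by rw [hGp]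
  have hE3 : C * Qb * Ha ≤ G :=
    calc C * Qb * Ha ≤ 1 * 1 * G := mul_le_mul (mul_le_mul hC1 hQb1 hQb0 zero_le_one) hHaG hHa0 (by positivity)
      _ = G := by ring
  have hE3' : 0 ≤ C * Qb * Ha := by positivity
  have ht3 : |(C * Qb * Ha) * K' * av * Bv / y| ≤ G * (p * s * x) := by
    rw [abs_div, abs_mul, abs_mul, abs_mul, abs_of_nonneg hE3', abs_of_nonneg ha0, abs_of_pos hy0,
      div_le_iff₀ hy0]
    calc C * Qb * Ha * |K'| * av * |Bv| ≤ G * (p * s) * 1 * (x * y) :=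
          mul_le_mul (mul_le_mul (mul_le_mul hE3 hKb (abs_nonneg _) hG0) ha1 ha0 (by positivity)) hB1
            (abs_nonneg _) (by positivity)
      _ = G * (p * s * x) * y := by ring
  have hE4 : C * Qb * Ha * Ku ≤ G :=
    calc C * Qb * Ha * Ku ≤ G * 1 := mul_le_mul hE3 hK1 hK0 hG0
      _ = G := mul_one G
  have hE4' : 0 ≤ C * Qb * Ha * Ku := by positivity
  have ht4 : |(C * Qb * Ha * Ku) * Bv / y| ≤ G * x := by
    rw [abs_div, abs_mul, abs_of_nonneg hE4', abs_of_pos hy0, div_le_iff₀ hy0]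
    calc C * Qb * Ha * Ku * |Bv| ≤ G * (x * y) := mul_le_mul hE4 hB1 (abs_nonneg _) hG0
      _ = G * x * y := by ring
  have ht5 : |(C * Qb * Ha * Ku) * av * B' / y| ≤ G * (p * x + 2 * p ^ 2 * x) := by
    rw [abs_div, abs_mul, abs_mul, abs_of_nonneg hE4', abs_of_nonneg ha0, abs_of_pos hy0, div_le_iff₀ hy0]
    calc C * Qb * Ha * Ku * av * |B'| ≤ G * 1 * (p * (x * y + 2 * (p * (x * y)))) :=
          mul_le_mul (mul_le_mul hE4 ha1 ha0 hG0) hBb (abs_nonneg _) (by positivity)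
      _ = G * (p * x + 2 * p ^ 2 * x) * y := by ring
  calc |-(C * v * (p * s - 1) * Qa * Ha * Ku * av) * (Z' * Bv) / y +
        (C * Qb * (p * s) * Hb * Ku * av) * ((Z' * Bv) / (1 - Zu) ^ 2) * (y / y) +
        (C * Qb * Ha) * K' * av * Bv / y + (C * Qb * Ha * Ku) * Bv / y + (C * Qb * Ha * Ku) * av * B' / y|
      ≤ |-(C * v * (p * s - 1) * Qa * Ha * Ku * av) * (Z' * Bv) / y| +
        |(C * Qb * (p * s) * Hb * Ku * av) * ((Z' * Bv) / (1 - Zu) ^ 2) * (y / y)| +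
        |(C * Qb * Ha) * K' * av * Bv / y| + |(C * Qb * Ha * Ku) * Bv / y| +
        |(C * Qb * Ha * Ku) * av * B' / y| := by
        refine (abs_add_le _ _).trans (add_le_add ((abs_add_le _ _).trans (add_le_add ((abs_add_le _ _).trans
          (add_le_add (abs_add_le _ _) le_rfl)) le_rfl)) le_rfl)
    _ ≤ 2 * (p * s) * G + 2 * (p * s) * G + G * (p * s * x) + G * x + G * (p * x + 2 * p ^ 2 * x) := by
        linarith [ht1, ht2, ht3, ht4, ht5]
    _ = G * (4 * (p * s) + p * s * x + x + p * x + 2 * p ^ 2 * x) := by ring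

set_option maxHeartbeats 400000 in
/-- **The one-variable heart**: along the `θ_i`-slice through `u ∈ U` the function
`a ↦ v^(px−1)(1 − vZ)^(ps−1)(y/(1−Z))^(ps) K · a · B / y` has a derivative bounded by an explicit
constant depending only on `p, s, x`. [folklore] -/
theorem fibre {x s : ℚ} (hx : 2 ≤ x) (hs : 3 ≤ s) {Θ T M : (Fin (n + 2) → ℝ) → Fin (n + 2) → ℝ}
    {Z K : (Fin (n + 2) → ℝ) → ℝ}
    (hΘ0 : ∀ u, Θ u 0 = 1 - ∑ i : Fin (n + 1), u (Fin.castSucc i))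
    (hΘs : ∀ u (i : Fin (n + 1)), Θ u i.succ = u (Fin.castSucc i))
    (hT : ∀ u k, T u k = 1 - u (Fin.last (n + 1)) * Θ u k)
    (hZ : ∀ u, Z u = (∏ k, T u k) ^ (1 / ((n:ℝ) + 2)))
    (hK : ∀ u, K u = (∏ k, Θ u k) ^ ((s:ℝ) - 1))
    (hM : ∀ u k, M u k = (T u k) ^ (x:ℝ) * ∏ j : Fin (n + 1), (T u (k + j.succ)) ^ ((x:ℝ) + (((j:ℕ):ℝ) + 1) / ((n:ℝ) + 2) - 1))
    {u : Fin (n + 2) → ℝ}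
    (hu : u ∈ {u : Fin (n + 2) → ℝ | (∀ i : Fin (n + 1), 0 < u (Fin.castSucc i)) ∧ ∑ i : Fin (n + 1), u (Fin.castSucc i) < 1 ∧ 0 < u (Fin.last (n + 1)) ∧ u (Fin.last (n + 1)) * (1 - ∑ i : Fin (n + 1), u (Fin.castSucc i)) < 1 ∧ ∀ i : Fin (n + 1), u (Fin.last (n + 1)) * u (Fin.castSucc i) < 1})
    (i : Fin (n + 1)) {v : ℝ} (hv0 : 0 < v) (hv1 : v < 1) :
    ∃ D, HasDerivAt (fun a =>
        v ^ (((n:ℝ) + 2) * (x:ℝ) - 1) *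
          (1 - v * Z (Function.update u (Fin.castSucc i) a)) ^ (((n:ℝ) + 2) * (s:ℝ) - 1) *
          (u (Fin.last (n + 1)) / (1 - Z (Function.update u (Fin.castSucc i) a))) ^ (((n:ℝ) + 2) * (s:ℝ)) *
          K (Function.update u (Fin.castSucc i) a) * a *
          (∑ j, Θ (Function.update u (Fin.castSucc i) a) j *
            (M (Function.update u (Fin.castSucc i) a) i.succ - M (Function.update u (Fin.castSucc i) a) j)) /
          u (Fin.last (n + 1))) D (u (Fin.castSucc i)) ∧
      |D| ≤ ((n:ℝ) + 2) ^ (((n:ℝ) + 2) * (s:ℝ)) *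
        (4 * (((n:ℝ) + 2) * s) + ((n:ℝ) + 2) * s * x + x + ((n:ℝ) + 2) * x + 2 * ((n:ℝ) + 2) ^ 2 * x) := by
  set y := u (Fin.last (n + 1)) with hy
  set p : ℝ := (n:ℝ) + 2 with hp
  obtain ⟨⟨hy0, hyp⟩, hΘb, hTb, ⟨hZ0, hZ1⟩, hgap⟩ := basic hΘ0 hΘs hT hZ hu
  obtain ⟨Z', hZd, hZb⟩ := Z_facts hΘ0 hΘs hT hZ hu i
  obtain ⟨⟨hK0, hK1⟩, K', hKd, hKb⟩ := K_facts hs hΘ0 hΘs hT hK hu i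
  obtain ⟨hB1, hB2, B', hBd, hBb⟩ := B_facts hx hΘ0 hΘs hT hM hu i
  have hp0 : 0 < p := by rw [hp]; positivity
  have hx' : (2:ℝ) ≤ x := by exact_mod_cast hx
  have hs' : (3:ℝ) ≤ s := by exact_mod_cast hs
  have hθ : 0 < u (Fin.castSucc i) ∧ u (Fin.castSucc i) < 1 := by
    have := hΘb i.succ; rwa [hΘs] at this
  -- the pieces `Q = 1 − vZ`, `Hf = y/(1 − Z)` and their powers
  have hQ0 : 0 < 1 - v * Z u := by nlinarith
  have hQ1 : 1 - v * Z u ≤ 1 := by nlinarith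
  have h1Z : 0 < 1 - Z u := by linarith
  have hHf0 : 0 < y / (1 - Z u) := div_pos hy0 h1Z
  have hHfp : y / (1 - Z u) ≤ p := by
    rw [div_le_iff₀ h1Z]
    have : y / p ≤ 1 - Z u := hgap
    rwa [div_le_iff₀ hp0, mul_comm] at this
  have hQd := ((hZd.const_mul v).const_sub 1).rpow_const (p := p * (s:ℝ) - 1)
    (Or.inl (by simp only [Function.update_eq_self]; exact hQ0.ne'))
  have hId := ((hZd.const_sub 1).fun_inv (by simp only [Function.update_eq_self]; exact h1Z.ne')).const_mul y
  have hHd : HasDerivAt (fun a => y / (1 - Z (Function.update u (Fin.castSucc i) a)))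
      (y * (-(-Z') / (1 - Z u) ^ 2)) (u (Fin.castSucc i)) := by
    simp only [Function.update_eq_self] at hId
    refine hId.congr_of_eventuallyEq (Filter.Eventually.of_forall fun a => ?_)
    simp only [div_eq_mul_inv]
  have hHpd := hHd.rpow_const (p := p * (s:ℝ))
    (Or.inl (by simp only [Function.update_eq_self]; exact hHf0.ne'))
  simp only [Function.update_eq_self] at hQd
  -- the product
  have hE := (((hQd.const_mul (v ^ (p * (x:ℝ) - 1))).fun_mul hHpd).fun_mul hKd)
  have hc := ((hE.fun_mul (hasDerivAt_id (u (Fin.castSucc i)))).fun_mul hBd).div_const y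
  simp only [Function.update_eq_self, id] at hc
  refine ⟨_, hc, ?_⟩
  -- abbreviations for the values at the base point
  set C := v ^ (p * (x:ℝ) - 1) with hC
  set Qa := (1 - v * Z u) ^ (p * (s:ℝ) - 1 - 1) with hQa
  set Qb := (1 - v * Z u) ^ (p * (s:ℝ) - 1) with hQb
  set Ha := (y / (1 - Z u)) ^ (p * (s:ℝ)) with hHa
  set Hb := (y / (1 - Z u)) ^ (p * (s:ℝ) - 1) with hHb
  set G := p ^ (p * (s:ℝ)) with hG
  set Bv := ∑ j, Θ u j * (M u i.succ - M u j) with hBv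
  set av := u (Fin.castSucc i) with hav
  -- ranges of the factors
  have hps : (6:ℝ) ≤ p * s := by nlinarith
  have hC0 : 0 ≤ C := rpow_nonneg hv0.le _
  have hC1 : C ≤ 1 := rpow_le_one hv0.le hv1.le (by nlinarith)
  have hQa0 : 0 ≤ Qa := rpow_nonneg hQ0.le _
  have hQa1 : Qa ≤ 1 := rpow_le_one hQ0.le hQ1 (by linarith)
  have hQb0 : 0 ≤ Qb := rpow_nonneg hQ0.le _
  have hQb1 : Qb ≤ 1 := rpow_le_one hQ0.le hQ1 (by linarith)
  have hG0 : 0 ≤ G := rpow_nonneg hp0.le _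
  have hHa0 : 0 ≤ Ha := rpow_nonneg hHf0.le _
  have hHaG : Ha ≤ G := rpow_le_rpow hHf0.le hHfp (by linarith)
  have hHb0 : 0 ≤ Hb := rpow_nonneg hHf0.le _
  have hHbG : Hb ≤ G / p := by
    rw [hG, ← rpow_sub_one hp0.ne']
    exact rpow_le_rpow hHf0.le hHfp (by linarith)
  have ha0 : 0 ≤ av := hθ.1.le
  have ha1 : av ≤ 1 := hθ.2.le
  have hT0 := (hTb 0).1
  have hTi := (hTb i.succ).1
  clear_value C Qa Qb Ha Hb G Bv av
  -- the two compensations, then the five-term estimate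
  have hZB : |Z'| * |Bv| ≤ 2 * (y ^ 2 * Z u / p) :=
    calc |Z'| * |Bv| ≤ |Z'| * (2 * (T u 0 * T u i.succ)) := mul_le_mul_of_nonneg_left hB2 (abs_nonneg _)
      _ = 2 * (|Z'| * (T u 0 * T u i.succ)) := by ring
      _ ≤ 2 * (y ^ 2 * Z u / p) := by gcongr
  have hZB1 : |Z'| * |Bv| ≤ 2 * y := by
    refine hZB.trans ?_
    have h : y ^ 2 * Z u / p ≤ y := by
      rw [div_le_iff₀ hp0]
      nlinarith [mul_pos hy0 hZ0, mul_pos hy0 hy0]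
    linarith
  have h1Zp : y / p ≤ 1 - Z u := hgap
  have hZB2 : |Z'| * |Bv| / (1 - Z u) ^ 2 ≤ 2 * p := by
    rw [div_le_iff₀ (pow_pos h1Z 2)]
    have hsq : (y / p) ^ 2 ≤ (1 - Z u) ^ 2 := pow_le_pow_left₀ (div_nonneg hy0.le hp0.le) h1Zp 2
    have hyZ : y ^ 2 * Z u / p ≤ y ^ 2 / p :=
      div_le_div_of_nonneg_right (mul_le_of_le_one_right (sq_nonneg y) hZ1.le) hp0.le
    have hpp : y ^ 2 / p = p * (y / p) ^ 2 := by field_simp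
    calc |Z'| * |Bv| ≤ 2 * (y ^ 2 * Z u / p) := hZB
      _ ≤ 2 * (y ^ 2 / p) := by linarith
      _ = 2 * p * (y / p) ^ 2 := by rw [hpp]; ring
      _ ≤ 2 * p * (1 - Z u) ^ 2 := mul_le_mul_of_nonneg_left hsq (by positivity)
  have key : ((((C * (-(v * Z') * (p * ↑s - 1) * Qa) * Ha + C * Qb * (y * (- -Z' / (1 - Z u) ^ 2) * (p * ↑s) * Hb)) *
        K u + C * Qb * Ha * K') * av + C * Qb * Ha * K u * 1) * Bv + C * Qb * Ha * K u * av * B') / y =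
      -(C * v * (p * s - 1) * Qa * Ha * K u * av) * (Z' * Bv) / y +
      (C * Qb * (p * s) * Hb * K u * av) * ((Z' * Bv) / (1 - Z u) ^ 2) * (y / y) +
      (C * Qb * Ha) * K' * av * Bv / y +
      (C * Qb * Ha * K u) * Bv / y +
      (C * Qb * Ha * K u) * av * B' / y := by
    ring
  rw [key]
  have hp2 : (2:ℝ) ≤ p := by rw [hp]; linarith [n.cast_nonneg (α := ℝ)]
  exact five_terms_le hC0 hC1 hv0.le hv1.le hp0 hp2 hs' hx' hQa0 hQa1 hQb0 hQb1 hG0 hHa0 hHaG hHb0 hHbG hK0.le hK1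
    ha0 ha1 hy0 h1Z hZB1 hZB2 hB1 (hKb.trans (by nlinarith)) hBb

end CornerThetaDeriv

/-- **The `θ_i`-derivative of the lateral Stokes component is bounded on the chart domain**
(registered sub-goal `cornerThetaDerivBoundGen` of the crux line, all `p = n + 2`, `x ≥ 2`, `s ≥ 3`):
there is a function `d`, bounded on `W`, with `∂_{θ_i} Vθ i (w) = d w` at every `w ∈ W`. On `W`,
`H = y/(1 − Z)` (`CornerGraphGen.S_pos_H`), so along the slice `Vθ i` is the function of
`CornerThetaDeriv.fibre`. [cite: KontsevichZagier2001, §1.2 rule (3)] -/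
theorem cornerThetaDerivBoundGen : ∀ (n : ℕ) (x s : ℚ), 2 ≤ x → 3 ≤ s → ∀ (Θ T : (Fin (n + 2) → ℝ) → Fin (n + 2) → ℝ) (Z S H K : (Fin (n + 2) → ℝ) → ℝ)
      (M : (Fin (n + 2) → ℝ) → Fin (n + 2) → ℝ) (P : (Fin (n + 3) → ℝ) → ℝ),
    (∀ u, Θ u 0 = 1 - ∑ i : Fin (n + 1), u (Fin.castSucc i)) → (∀ u (i : Fin (n + 1)), Θ u i.succ = u (Fin.castSucc i)) →
    (∀ u k, T u k = 1 - u (Fin.last (n + 1)) * Θ u k) →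
    (∀ u, Z u = (∏ k, T u k) ^ (1 / ((n:ℝ) + 2))) →
    (∀ u, S u = ∑ j ∈ Finset.range (n + 2), (-1:ℝ) ^ j * u (Fin.last (n + 1)) ^ j *
      ∑ A ∈ Finset.powersetCard (j + 1) (Finset.univ : Finset (Fin (n + 2))), ∏ k ∈ A, Θ u k) →
    (∀ u, H u = (∑ j ∈ Finset.range (n + 2), Z u ^ j) / S u) →
    (∀ u, K u = (∏ k, Θ u k) ^ ((s:ℝ) - 1)) →
    (∀ u k, M u k = (T u k) ^ (x:ℝ) * ∏ j : Fin (n + 1), (T u (k + j.succ)) ^ ((x:ℝ) + (((j:ℕ):ℝ) + 1) / ((n:ℝ) + 2) - 1)) →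
    (∀ w, P w = (w (Fin.last (n + 2))) ^ (((n:ℝ) + 2) * (x:ℝ) - 1) *
      (1 - w (Fin.last (n + 2)) * Z (Fin.init w)) ^ (((n:ℝ) + 2) * (s:ℝ) - 1) * H (Fin.init w) ^ (((n:ℝ) + 2) * (s:ℝ)) * K (Fin.init w)) →
    ∀ (Vθ : Fin (n + 1) → (Fin (n + 3) → ℝ) → ℝ), (∀ (i : Fin (n + 1)) w, Vθ i w = P w * (Fin.init w : Fin (n + 2) → ℝ) (Fin.castSucc i) *
      (∑ j, Θ (Fin.init w) j * (M (Fin.init w) i.succ - M (Fin.init w) j)) / (Fin.init w : Fin (n + 2) → ℝ) (Fin.last (n + 1))) →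
    ∀ i : Fin (n + 1), ∃ d : (Fin (n + 3) → ℝ) → ℝ, (∃ C : ℝ, ∀ w ∈ {w : Fin (n + 3) → ℝ | (Fin.init w : Fin (n + 2) → ℝ) ∈ {u : Fin (n + 2) → ℝ | (∀ i : Fin (n + 1), 0 < u (Fin.castSucc i)) ∧ ∑ i : Fin (n + 1), u (Fin.castSucc i) < 1 ∧ 0 < u (Fin.last (n + 1)) ∧ u (Fin.last (n + 1)) * (1 - ∑ i : Fin (n + 1), u (Fin.castSucc i)) < 1 ∧ ∀ i : Fin (n + 1), u (Fin.last (n + 1)) * u (Fin.castSucc i) < 1} ∧ 0 < w (Fin.last (n + 2)) ∧ w (Fin.last (n + 2)) < 1}, |d w| ≤ C) ∧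
      ∀ w ∈ {w : Fin (n + 3) → ℝ | (Fin.init w : Fin (n + 2) → ℝ) ∈ {u : Fin (n + 2) → ℝ | (∀ i : Fin (n + 1), 0 < u (Fin.castSucc i)) ∧ ∑ i : Fin (n + 1), u (Fin.castSucc i) < 1 ∧ 0 < u (Fin.last (n + 1)) ∧ u (Fin.last (n + 1)) * (1 - ∑ i : Fin (n + 1), u (Fin.castSucc i)) < 1 ∧ ∀ i : Fin (n + 1), u (Fin.last (n + 1)) * u (Fin.castSucc i) < 1} ∧ 0 < w (Fin.last (n + 2)) ∧ w (Fin.last (n + 2)) < 1},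
        HasDerivAt (fun a => Vθ i (Function.update w (Fin.castSucc (Fin.castSucc i) : Fin (n + 3)) a)) (d w) (w (Fin.castSucc (Fin.castSucc i) : Fin (n + 3))) := by
  intro n x s hx hs Θ T Z S H K M P hΘ0 hΘs hT hZ hS hH hK hM hP Vθ hVθ i
  set Wo : Set (Fin (n + 3) → ℝ) := {w : Fin (n + 3) → ℝ | (Fin.init w : Fin (n + 2) → ℝ) ∈ {u : Fin (n + 2) → ℝ | (∀ i : Fin (n + 1), 0 < u (Fin.castSucc i)) ∧ ∑ i : Fin (n + 1), u (Fin.castSucc i) < 1 ∧ 0 < u (Fin.last (n + 1)) ∧ u (Fin.last (n + 1)) * (1 - ∑ i : Fin (n + 1), u (Fin.castSucc i)) < 1 ∧ ∀ i : Fin (n + 1), u (Fin.last (n + 1)) * u (Fin.castSucc i) < 1} ∧ 0 < w (Fin.last (n + 2)) ∧ w (Fin.last (n + 2)) < 1} with hWo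
  have key : ∀ w ∈ Wo, ∃ D, HasDerivAt (fun a => Vθ i (Function.update w (Fin.castSucc (Fin.castSucc i) : Fin (n + 3)) a)) D
      (w (Fin.castSucc (Fin.castSucc i) : Fin (n + 3))) ∧
      |D| ≤ ((n:ℝ) + 2) ^ (((n:ℝ) + 2) * (s:ℝ)) *
        (4 * (((n:ℝ) + 2) * s) + ((n:ℝ) + 2) * s * x + x + ((n:ℝ) + 2) * x + 2 * ((n:ℝ) + 2) ^ 2 * x) := by
    intro w hw
    obtain ⟨hu, hv0, hv1⟩ := hw
    set u : Fin (n + 2) → ℝ := Fin.init w with hudef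
    obtain ⟨D, hD, hDb⟩ := CornerThetaDeriv.fibre hx hs hΘ0 hΘs hT hZ hK hM hu i hv0 hv1
    refine ⟨D, ?_, hDb⟩
    have hpt : w (Fin.castSucc (Fin.castSucc i)) = u (Fin.castSucc i) := rfl
    rw [hpt]
    refine hD.congr_of_eventuallyEq ?_
    have hev := CornerClosedG.eventually_update_mem hu (Fin.castSucc i)
    refine hev.mono fun a ha => ?_
    -- unfold the component at the updated point
    have hinit : (Fin.init (Function.update w (Fin.castSucc (Fin.castSucc i)) a) : Fin (n + 2) → ℝ) =
        Function.update u (Fin.castSucc i) a := Fin.init_update_castSucc _ _ _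
    have hlast : Function.update w (Fin.castSucc (Fin.castSucc i) : Fin (n + 3)) a (Fin.last (n + 2)) =
        w (Fin.last (n + 2)) :=
      Function.update_of_ne (Fin.castSucc_lt_last _).ne' _ _
    have hHZ := (CornerGraphGen.S_pos_H hΘ0 hΘs hT hZ hS hH ha)
    obtain ⟨-, ⟨-, hZ1⟩, -, hHeq⟩ := hHZ
    have hHval : H (Function.update u (Fin.castSucc i) a) =
        u (Fin.last (n + 1)) / (1 - Z (Function.update u (Fin.castSucc i) a)) := by
      rw [eq_div_iff (by linarith), hHeq, CornerThetaDeriv.update_last]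
    simp only [hVθ, hP, hinit, hlast, hHval, Function.update_self, CornerThetaDeriv.update_last]
  choose! d hd using key
  exact ⟨d, ⟨_, fun w hw => (hd w hw).2⟩, fun w hw => (hd w hw).1⟩

end Summit.KontsevichZagierPeriods.TerasomaMultiplication.MultiplicationAccessible

end
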